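import Summits.ValiantsHypothesis.ValiantsHypothesis.Theorems.LacunarySymmetroidMatrixDescartesDoorA26WallBubblingConfluentCount

/-!
# Wall bubbling for `DoorA26` — the DOUBLY-CONFLUENT `(2,6)` determinant: `20` slots, `≤ 19` zeros with multiplicity UNCONDITIONALLY

LINE / STUBS.  Crux `Theses.LacunarySymmetroid.DoorA26` (stmt-ValiantsHypothesis-19979; OPEN, typed, never asserted), line
`Cruxes/DoorA26/Lines/wall_bubbling.lean` (val-idea-15), obligation (W) `Stmt.stub_weylFaces`, statement file
`Cruxes/DoorA26/Lines/wall_bubbling_ConfluentDoor.lean` rev 4: the TWO-WEYL-PAIR strata — `Stmt.weylFaces_deepVal` for `r = 4` distinct values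
(value-generic) and `Stmt.weylFaces_wall` with two Weyl pairs (one disjoint-type value relation (c1) `e₀ + e₁ = e₂ + e₃` or (c2)/(c3)
`e₀ + e₂ = e₁ + e₃` / `e₀ + e₃ = e₁ + e₂`; W1 #14 `…WallExitMoments` itemisation, (c1) per cluster W1 #19, (c2)/(c3) NAMED OPEN R2779).

THE ESCAPE OBJECT AT TWO WEYL PAIRS.  By the two-dslope FRAME IDENTITY (this seat's next file; one pair: W2 `…ConfluentLimit.frame_det`) the
Gram-normalised limit of ANY cluster of a sequence of `(2,6)` pencils whose exponents converge to a point with two Weyl pairs `δᵢ = δⱼ = e₀`,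
`δᵢ′ = δⱼ′ = e₁` and two further values `e₂, e₃` is the determinant of a **DOUBLY-CONFLUENT** symmetric pencil

  `F(t) = det( e^{e₀t}(τ + t·T) + e^{e₁t}(τ′ + t·T′) + e^{e₂t} S₀ + e^{e₃t} S₁ )`,   `τ, T, τ′, T′, S_k ∈ Sym₂(ℝ)`.

This file is its COUNT (def-free, the determinant written inline exactly as above, `E = (e₀, e₁, e₂, e₃) : Fin 4 → ℝ`):

* `doublyConfluentDet_extSum` — `F` is an extended exponential sum `Σ_{w ∈ F} P_w(t) e^{wt}` over the set `F` of pair sums of `E`, with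
  `deg P_w ≤ 2` on the classes `2e₀, 2e₁, e₀ + e₁`, `≤ 1` on the classes `e₀ + e_k, e₁ + e_k` (`k = 2, 3`), `0` elsewhere;
* `card_pairSums_four` (`|F| ≤ 10`, `≤ 9` under a coincidence of two distinct canonical pairs), `doublyConfluentDet_slots_le`
  (`Σ slots ≤ |F| + 6 + |{e₀+e₂, e₀+e₃, e₁+e₂, e₁+e₃}|`), `card_crossSums_le_four` / `card_crossSums_le_three_of_rel`;
* **`doublyConfluentDet_zerosWithMultiplicity_le_nineteen`** — if `F ≢ 0` then its real zeros COUNTED WITH MULTIPLICITY number `≤ 19`,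
  for EVERY `E` (no injectivity, no door): slots `3 + 3 + 3 + 4·2 + 3 = 20`, one less than the 21 of a single confluent letter, because the
  four members `ii′, ij′, ji′, jj′` of the class `e₀ + e₁` span only the THREE slot functions `{1, t, t²}·e^{(e₀+e₁)t}` of `polar(τ + tT, τ′ + tT′)`
  — the number `ConfluentDoor26` has to ASK for at one Weyl pair is AUTOMATIC at two;
* `…_le_eighteen_of_coincidence` — `≤ 18` under any coincidence of two distinct canonical pair sums of `E` (covers (c1), (c2), (c3));
  `…_le_seventeen_of_crossRel` — `≤ 17` under (c2) `e₀ + e₂ = e₁ + e₃` or (c3) `e₀ + e₃ = e₁ + e₂` (a cross class merges as well);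
* `doublyConfluent_count_conclusion` — the same in the `Σ_{z∈Z} m z ≤ 19` shape that W2's door step consumes (`…ConfluentTower`).

USE (this seat's files #25–#26): with the two-dslope frame identity, Gram normalisation, closedness of `Realisable` and NON-DEGENERACY of the
limit by inertia (the cancelling patterns are the non-realisable (D)-patterns of W1 #13), the single-cluster branch at every two-Weyl-pair point of
`weylFaces_deepVal` / `weylFaces_wall` is DOOR-FREE.  Multi-cluster chains keep the shared (W-split) middle (W2), now with 20-slot data.
Nothing in this file bears on (W)/(M)/(R) themselves, on `DoorA26`, on `MatrixDescartes` (stmt-ValiantsHypothesis-18050) or on `VP ≠ VNP`;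
registers unchanged.

Seat val-sym-door-p2 g13 (W1 #24), `--supports stmt-ValiantsHypothesis-19979 --as helper`. [folklore: Laguerre 1898; Pólya–Szegő 1976 Part V]
[this work] the slot bookkeeping of the doubly-confluent `(2,6)` determinant.
-/

-- `Summit.ValiantsHypothesis.ValiantsHypothesis.…` repeats a component by the D-0017 layout
-- (single-conjunct summit), which the `dupNamespace` linter flags; the name is mandated.
set_option linter.dupNamespace false

namespace Summit.ValiantsHypothesis.ValiantsHypothesis.Theorems.LacunarySymmetroidMatrixDescartes.WallBubbling.Bubbling

open Finset Filter Topology Polynomial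
open Literature.Analysis.TotalPositivity.LaguerreRuleOfSigns (ZerosWithMultiplicityLE)

/-! ## 1. The doubly-confluent determinant as an extended exponential sum -/

/-- **The doubly-confluent determinant is an extended exponential sum**, `F` = the set of pair sums of the four exponents:
`det(e^{e₀t}(τ + tT) + e^{e₁t}(τ′ + tT′) + e^{e₂t}S₀ + e^{e₃t}S₁) = Σ_{w ∈ F} P_w(t) e^{wt}` with `deg P_w ≤ 2` on the classes `2e₀, 2e₁, e₀+e₁`,
`≤ 1` on the classes `e₀ + e_k, e₁ + e_k` (`k = 2,3`), `0` elsewhere (existential packaging of the coefficient polynomials). [folklore] -/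
theorem doublyConfluentDet_extSum (E : Fin 4 → ℝ) (τ T τ' T' : Matrix (Fin 2) (Fin 2) ℝ) (S : Fin 2 → Matrix (Fin 2) (Fin 2) ℝ) :
    ∃ P : ℝ → ℝ[X],
      (∀ t : ℝ, ((Real.exp (E 0 * t)) • (τ + t • T) + (Real.exp (E 1 * t)) • (τ' + t • T')
            + ∑ k, (Real.exp (E k.succ.succ * t)) • S k).det
        = ∑ w ∈ (univ : Finset (Fin 4 × Fin 4)).image (fun p => E p.1 + E p.2), (P w).eval t * Real.exp (w * t)) ∧
      (∀ w, (P w).natDegree ≤ (if w ∈ ({E 0 + E 0, E 0 + E 1, E 1 + E 1} : Finset ℝ) then 2 else 0) +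
        (if w ∈ (univ : Finset (Fin 2)).image (fun k => E 0 + E k.succ.succ) ∪ (univ : Finset (Fin 2)).image (fun k => E 1 + E k.succ.succ)
          then 1 else 0)) := by
  classical
  -- polynomial letters
  let L : Fin 4 → Matrix (Fin 2) (Fin 2) ℝ[X] :=
    Fin.cases (τ.map C + (X : ℝ[X]) • T.map C)
      (fun m : Fin 3 => (Fin.cases (τ'.map C + (X : ℝ[X]) • T'.map C) (fun k : Fin 2 => (S k).map C) m : Matrix (Fin 2) (Fin 2) ℝ[X]))
  have hL0 : ∀ i j, L 0 i j = C (τ i j) + X * C (T i j) := by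
    intro i j
    show (Fin.cases (τ.map C + (X : ℝ[X]) • T.map C)
      (fun m : Fin 3 => (Fin.cases (τ'.map C + (X : ℝ[X]) • T'.map C) (fun k : Fin 2 => (S k).map C) m : Matrix (Fin 2) (Fin 2) ℝ[X]))
      (0 : Fin 4) : Matrix (Fin 2) (Fin 2) ℝ[X]) i j = _
    rw [Fin.cases_zero, Matrix.add_apply, Matrix.smul_apply, Matrix.map_apply, Matrix.map_apply, smul_eq_mul, mul_comm]
  have hL1 : ∀ i j, L 1 i j = C (τ' i j) + X * C (T' i j) := by
    intro i j
    show (Fin.cases (τ.map C + (X : ℝ[X]) • T.map C)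
      (fun m : Fin 3 => (Fin.cases (τ'.map C + (X : ℝ[X]) • T'.map C) (fun k : Fin 2 => (S k).map C) m : Matrix (Fin 2) (Fin 2) ℝ[X]))
      ((0 : Fin 3).succ) : Matrix (Fin 2) (Fin 2) ℝ[X]) i j = _
    rw [Fin.cases_succ, Fin.cases_zero, Matrix.add_apply, Matrix.smul_apply, Matrix.map_apply, Matrix.map_apply, smul_eq_mul, mul_comm]
  have hLs : ∀ (k : Fin 2) i j, L k.succ.succ i j = C (S k i j) := by
    intro k i j
    show (Fin.cases (τ.map C + (X : ℝ[X]) • T.map C)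
      (fun m : Fin 3 => (Fin.cases (τ'.map C + (X : ℝ[X]) • T'.map C) (fun k : Fin 2 => (S k).map C) m : Matrix (Fin 2) (Fin 2) ℝ[X]))
      k.succ.succ : Matrix (Fin 2) (Fin 2) ℝ[X]) i j = _
    rw [Fin.cases_succ, Fin.cases_succ, Matrix.map_apply]
  -- degrees of the letters: `≤ 1` at the two confluent positions, `0` elsewhere
  have hlin : ∀ (A B : Matrix (Fin 2) (Fin 2) ℝ) (i j : Fin 2), (C (A i j) + X * C (B i j)).natDegree ≤ 1 := by
    intro A B i j
    refine (natDegree_add_le _ _).trans ?_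
    rw [natDegree_C, Nat.zero_max]
    refine (natDegree_mul_le).trans ?_
    rw [natDegree_C, add_zero]
    exact natDegree_X_le
  have hdeg0 : ∀ i j, (L 0 i j).natDegree ≤ 1 := fun i j => by rw [hL0]; exact hlin τ T i j
  have hdeg1 : ∀ i j, (L 1 i j).natDegree ≤ 1 := fun i j => by rw [hL1]; exact hlin τ' T' i j
  have hdegs : ∀ (k : Fin 2) i j, (L k.succ.succ i j).natDegree = 0 := fun k i j => by rw [hLs, natDegree_C]
  -- entries of the pencil
  have heval : ∀ (i j : Fin 2) (t : ℝ), ((Real.exp (E 0 * t)) • (τ + t • T) + (Real.exp (E 1 * t)) • (τ' + t • T')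
        + ∑ k, (Real.exp (E k.succ.succ * t)) • S k) i j
      = ∑ a, Real.exp (E a * t) * (L a i j).eval t := by
    intro i j t
    have lhs : ((Real.exp (E 0 * t)) • (τ + t • T) + (Real.exp (E 1 * t)) • (τ' + t • T')
          + ∑ k, (Real.exp (E k.succ.succ * t)) • S k) i j
        = Real.exp (E 0 * t) * (τ i j + t * T i j) + Real.exp (E 1 * t) * (τ' i j + t * T' i j)
          + ∑ k, Real.exp (E k.succ.succ * t) * S k i j := by
      rw [Matrix.add_apply, Matrix.add_apply, Matrix.smul_apply, Matrix.smul_apply, Matrix.sum_apply, Matrix.add_apply, Matrix.add_apply,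
        Matrix.smul_apply, Matrix.smul_apply]
      simp only [Matrix.smul_apply, smul_eq_mul]
    rw [lhs, Fin.sum_univ_succ (f := fun a => Real.exp (E a * t) * (L a i j).eval t),
      Fin.sum_univ_succ (f := fun m : Fin 3 => Real.exp (E m.succ * t) * (L m.succ i j).eval t)]
    have h1 : ((0 : Fin 3).succ : Fin 4) = 1 := rfl
    simp only [h1, hL0, hL1]
    have rhs : ∀ k : Fin 2, Real.exp (E k.succ.succ * t) * (L k.succ.succ i j).eval t = Real.exp (E k.succ.succ * t) * S k i j := by
      intro k; rw [hLs, eval_C]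
    simp only [rhs, eval_add, eval_mul, eval_C, eval_X]
    ring
  -- the pair terms and the coefficient polynomials
  let term : Fin 4 × Fin 4 → ℝ[X] := fun p => L p.1 0 0 * L p.2 1 1 - L p.1 0 1 * L p.2 1 0
  let F : Finset ℝ := (univ : Finset (Fin 4 × Fin 4)).image (fun p => E p.1 + E p.2)
  let P : ℝ → ℝ[X] := fun w => ∑ p ∈ (univ : Finset (Fin 4 × Fin 4)).filter (fun p => E p.1 + E p.2 = w), term p
  refine ⟨P, fun t => ?_, fun w => ?_⟩
  · -- the determinant, expanded and regrouped by pair-sum values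
    rw [Matrix.det_fin_two, heval 0 0 t, heval 1 1 t, heval 0 1 t, heval 1 0 t]
    have hexp : ∀ p : Fin 4 × Fin 4, Real.exp (E p.1 * t) * Real.exp (E p.2 * t) = Real.exp ((E p.1 + E p.2) * t) := by
      intro p; rw [← Real.exp_add]; ring_nf
    have hpairs : (∑ a, Real.exp (E a * t) * (L a 0 0).eval t) * (∑ a, Real.exp (E a * t) * (L a 1 1).eval t)
        - (∑ a, Real.exp (E a * t) * (L a 0 1).eval t) * (∑ a, Real.exp (E a * t) * (L a 1 0).eval t)
        = ∑ p : Fin 4 × Fin 4, (term p).eval t * Real.exp ((E p.1 + E p.2) * t) := by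
      rw [← Finset.univ_product_univ, Finset.sum_product, Finset.sum_mul_sum, Finset.sum_mul_sum, ← Finset.sum_sub_distrib]
      refine Finset.sum_congr rfl fun a _ => ?_
      rw [← Finset.sum_sub_distrib]
      refine Finset.sum_congr rfl fun b _ => ?_
      simp only [term, eval_sub, eval_mul]
      rw [← hexp (a, b)]
      ring
    rw [hpairs]
    symm
    rw [← Finset.sum_fiberwise_of_maps_to (s := (univ : Finset (Fin 4 × Fin 4))) (t := F) (g := fun p => E p.1 + E p.2)
      (fun p hp => Finset.mem_image_of_mem _ hp)]
    refine Finset.sum_congr rfl fun w _ => ?_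
    simp only [P, eval_finsetSum, Finset.sum_mul]
    refine Finset.sum_congr rfl fun p hp => ?_
    rw [(Finset.mem_filter.mp hp).2]
  · -- degree bound per class
    refine (natDegree_sum_le_of_forall_le _ _ fun p hp => ?_)
    have hw : E p.1 + E p.2 = w := (Finset.mem_filter.mp hp).2
    -- membership bookkeeping
    have memAA : ∀ a b : Fin 4, (a = 0 ∨ a = 1) → (b = 0 ∨ b = 1) →
        E a + E b ∈ ({E 0 + E 0, E 0 + E 1, E 1 + E 1} : Finset ℝ) := by
      rintro a b (rfl | rfl) (rfl | rfl)
      · simp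
      · simp
      · rw [add_comm (E 1) (E 0)]; simp
      · simp
    have memAO : ∀ (a : Fin 4) (k : Fin 2), (a = 0 ∨ a = 1) →
        E a + E k.succ.succ ∈ (univ : Finset (Fin 2)).image (fun k => E 0 + E k.succ.succ)
          ∪ (univ : Finset (Fin 2)).image (fun k => E 1 + E k.succ.succ) := by
      rintro a k (rfl | rfl)
      · exact Finset.mem_union_left _ (Finset.mem_image.mpr ⟨k, Finset.mem_univ _, rfl⟩)
      · exact Finset.mem_union_right _ (Finset.mem_image.mpr ⟨k, Finset.mem_univ _, rfl⟩)
    -- the degree of a term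
    have hconf : ∀ a : Fin 4, (a = 0 ∨ a = 1) ∨ ∃ k : Fin 2, a = k.succ.succ := by
      intro a
      rcases Fin.eq_zero_or_eq_succ a with rfl | ⟨m, rfl⟩
      · exact Or.inl (Or.inl rfl)
      · rcases Fin.eq_zero_or_eq_succ m with rfl | ⟨k, rfl⟩
        · exact Or.inl (Or.inr rfl)
        · exact Or.inr ⟨k, rfl⟩
    have hdegle : ∀ a : Fin 4, (a = 0 ∨ a = 1) → ∀ i j, (L a i j).natDegree ≤ 1 := by
      rintro a (rfl | rfl) i j
      · exact hdeg0 i j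
      · exact hdeg1 i j
    have hterm_le : ∀ da db : ℕ, (∀ i j, (L p.1 i j).natDegree ≤ da) → (∀ i j, (L p.2 i j).natDegree ≤ db) →
        (term p).natDegree ≤ da + db := by
      intro da db h1 h2
      refine (natDegree_sub_le _ _).trans (max_le ?_ ?_)
      · exact natDegree_mul_le.trans (add_le_add (h1 0 0) (h2 1 1))
      · exact natDegree_mul_le.trans (add_le_add (h1 0 1) (h2 1 0))
    rcases hconf p.1 with ha | ⟨ka, hka⟩ <;> rcases hconf p.2 with hb | ⟨kb, hkb⟩
    · -- both confluent: degree ≤ 2, class in AA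
      have h := hterm_le 1 1 (hdegle p.1 ha) (hdegle p.2 hb)
      rw [if_pos (by rw [← hw]; exact memAA p.1 p.2 ha hb)]
      omega
    · -- confluent × ordinary
      have h := hterm_le 1 0 (hdegle p.1 ha) (fun i j => by rw [hkb, hdegs])
      have hmem := memAO p.1 kb ha
      rw [← hkb, hw] at hmem
      rw [if_pos hmem]
      omega
    · -- ordinary × confluent
      have h := hterm_le 0 1 (fun i j => by rw [hka, hdegs]) (hdegle p.2 hb)
      have hmem := memAO p.2 ka hb
      rw [← hka, add_comm (E p.2) (E p.1), hw] at hmem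
      rw [if_pos hmem]
      omega
    · -- ordinary × ordinary
      have h := hterm_le 0 0 (fun i j => by rw [hka, hdegs]) (fun i j => by rw [hkb, hdegs])
      omega

/-! ## 2. Slot count -/

/-- The cross classes `e₀ + e_k, e₁ + e_k` (`k = 2, 3`) number at most four. [folklore] -/
theorem card_crossSums_le_four (E : Fin 4 → ℝ) :
    ((univ : Finset (Fin 2)).image (fun k => E 0 + E k.succ.succ) ∪ (univ : Finset (Fin 2)).image (fun k => E 1 + E k.succ.succ)).card
      ≤ 4 := by
  classical
  refine (Finset.card_union_le _ _).trans ?_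
  have h1 : ((univ : Finset (Fin 2)).image (fun k => E 0 + E k.succ.succ)).card ≤ 2 := Finset.card_image_le.trans (by simp)
  have h2 : ((univ : Finset (Fin 2)).image (fun k => E 1 + E k.succ.succ)).card ≤ 2 := Finset.card_image_le.trans (by simp)
  omega

/-- Under a CROSS RELATION `e₀ + e_k = e₁ + e_l` (the wall cases (c2) `e₀ + e₂ = e₁ + e₃` / (c3) `e₀ + e₃ = e₁ + e₂`) the cross classes
number at most three. [folklore] -/
theorem card_crossSums_le_three_of_rel (E : Fin 4 → ℝ) (hrel : ∃ k l : Fin 2, E 0 + E k.succ.succ = E 1 + E l.succ.succ) :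
    ((univ : Finset (Fin 2)).image (fun k => E 0 + E k.succ.succ) ∪ (univ : Finset (Fin 2)).image (fun k => E 1 + E k.succ.succ)).card
      ≤ 3 := by
  classical
  obtain ⟨k, l, hkl⟩ := hrel
  set A := (univ : Finset (Fin 2)).image (fun k => E 0 + E k.succ.succ) with hA
  set B := (univ : Finset (Fin 2)).image (fun k => E 1 + E k.succ.succ) with hB
  have h1 : A.card ≤ 2 := Finset.card_image_le.trans (by simp)
  have h2 : B.card ≤ 2 := Finset.card_image_le.trans (by simp)
  have hcommon : E 0 + E k.succ.succ ∈ A ∩ B := by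
    refine Finset.mem_inter.mpr ⟨Finset.mem_image.mpr ⟨k, Finset.mem_univ _, rfl⟩, ?_⟩
    rw [hkl]
    exact Finset.mem_image.mpr ⟨l, Finset.mem_univ _, rfl⟩
  have h3 : 1 ≤ (A ∩ B).card := Finset.card_pos.mpr ⟨_, hcommon⟩
  have h4 := Finset.card_union_add_card_inter A B
  omega

/-- **Slot count.**  With `F` and `P` as in `doublyConfluentDet_extSum`,
`Σ_{w∈F} [P_w ≠ 0](deg P_w + 1) ≤ |F| + 6 + |cross classes|`. [folklore] -/
theorem doublyConfluentDet_slots_le (E : Fin 4 → ℝ) (P : ℝ → ℝ[X])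
    (hP : ∀ w, (P w).natDegree ≤ (if w ∈ ({E 0 + E 0, E 0 + E 1, E 1 + E 1} : Finset ℝ) then 2 else 0) +
      (if w ∈ (univ : Finset (Fin 2)).image (fun k => E 0 + E k.succ.succ) ∪ (univ : Finset (Fin 2)).image (fun k => E 1 + E k.succ.succ)
        then 1 else 0)) :
    (∑ w ∈ (univ : Finset (Fin 4 × Fin 4)).image (fun p => E p.1 + E p.2), if P w = 0 then 0 else (P w).natDegree + 1)
      ≤ ((univ : Finset (Fin 4 × Fin 4)).image (fun p => E p.1 + E p.2)).card + 6
        + ((univ : Finset (Fin 2)).image (fun k => E 0 + E k.succ.succ) ∪ (univ : Finset (Fin 2)).image (fun k => E 1 + E k.succ.succ)).card := by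
  classical
  set F := (univ : Finset (Fin 4 × Fin 4)).image (fun p => E p.1 + E p.2) with hF
  set AA : Finset ℝ := {E 0 + E 0, E 0 + E 1, E 1 + E 1} with hAA
  set AO := (univ : Finset (Fin 2)).image (fun k => E 0 + E k.succ.succ) ∪ (univ : Finset (Fin 2)).image (fun k => E 1 + E k.succ.succ)
    with hAO
  have h1 : (∑ w ∈ F, if P w = 0 then 0 else (P w).natDegree + 1)
      ≤ ∑ w ∈ F, (1 + ((if w ∈ AA then 2 else 0) + (if w ∈ AO then 1 else 0))) := by
    refine Finset.sum_le_sum fun w _ => ?_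
    have := hP w
    by_cases h : P w = 0
    · rw [if_pos h]; omega
    · rw [if_neg h]; omega
  refine h1.trans ?_
  rw [Finset.sum_add_distrib, Finset.sum_const, smul_eq_mul, mul_one, Finset.sum_add_distrib]
  have hAAcard : AA.card ≤ 3 := by
    rw [hAA]
    exact (Finset.card_insert_le _ _).trans (Nat.succ_le_succ ((Finset.card_insert_le _ _).trans (by simp)))
  have h2 : (∑ w ∈ F, if w ∈ AA then 2 else 0) ≤ 6 := by
    rw [← Finset.sum_filter, Finset.sum_const, smul_eq_mul]
    have : (F.filter (fun w => w ∈ AA)).card ≤ AA.card := Finset.card_le_card (fun w hw => (Finset.mem_filter.mp hw).2)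
    omega
  have h3 : (∑ w ∈ F, if w ∈ AO then 1 else 0) ≤ AO.card := by
    rw [← Finset.sum_filter, Finset.sum_const, smul_eq_mul, mul_one]
    exact Finset.card_le_card (fun w hw => (Finset.mem_filter.mp hw).2)
  omega

/-- The set of pair sums of four reals has at most `10` elements, and at most `9` if two distinct canonical pairs have the same sum. [folklore] -/
theorem card_pairSums_four (E : Fin 4 → ℝ) :
    ((univ : Finset (Fin 4 × Fin 4)).image (fun p => E p.1 + E p.2)).card ≤ 10 ∧
    ((∃ a b c d : Fin 4, a ≤ b ∧ c ≤ d ∧ (a, b) ≠ (c, d) ∧ E a + E b = E c + E d) →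
      ((univ : Finset (Fin 4 × Fin 4)).image (fun p => E p.1 + E p.2)).card ≤ 9) := by
  classical
  set Cn : Finset (Fin 4 × Fin 4) := univ.filter (fun p => p.1 ≤ p.2) with hCn
  have hCcard : Cn.card = 10 := by rw [hCn]; decide
  -- every pair sum is the sum of a canonical pair
  have hsub : (univ : Finset (Fin 4 × Fin 4)).image (fun p => E p.1 + E p.2) ⊆ Cn.image (fun p => E p.1 + E p.2) := by
    intro w hw
    obtain ⟨p, -, rfl⟩ := Finset.mem_image.mp hw
    rcases le_total p.1 p.2 with h | h
    · exact Finset.mem_image.mpr ⟨p, Finset.mem_filter.mpr ⟨Finset.mem_univ _, h⟩, rfl⟩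
    · exact Finset.mem_image.mpr ⟨(p.2, p.1), Finset.mem_filter.mpr ⟨Finset.mem_univ _, h⟩, by simp [add_comm]⟩
  refine ⟨?_, ?_⟩
  · calc _ ≤ (Cn.image (fun p => E p.1 + E p.2)).card := Finset.card_le_card hsub
      _ ≤ Cn.card := Finset.card_image_le
      _ = 10 := hCcard
  · rintro ⟨a, b, c, d, hab, hcd, hne, hsum⟩
    have hab' : (a, b) ∈ Cn.erase (c, d) := Finset.mem_erase.mpr ⟨hne, Finset.mem_filter.mpr ⟨Finset.mem_univ _, hab⟩⟩
    have hsub' : Cn.image (fun p => E p.1 + E p.2) ⊆ (Cn.erase (c, d)).image (fun p => E p.1 + E p.2) := by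
      intro w hw
      obtain ⟨q, hq, rfl⟩ := Finset.mem_image.mp hw
      by_cases hqc : q = (c, d)
      · subst hqc
        exact Finset.mem_image.mpr ⟨(a, b), hab', hsum⟩
      · exact Finset.mem_image.mpr ⟨q, Finset.mem_erase.mpr ⟨hqc, hq⟩, rfl⟩
    have hcd' : (c, d) ∈ Cn := Finset.mem_filter.mpr ⟨Finset.mem_univ _, hcd⟩
    calc _ ≤ (Cn.image (fun p => E p.1 + E p.2)).card := Finset.card_le_card hsub
      _ ≤ ((Cn.erase (c, d)).image (fun p => E p.1 + E p.2)).card := Finset.card_le_card hsub'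
      _ ≤ (Cn.erase (c, d)).card := Finset.card_image_le
      _ = 9 := by rw [Finset.card_erase_of_mem hcd', hCcard]

/-! ## 3. Counts -/

/-- **Extended count of the doubly-confluent determinant from the number of classes.**  If `|F| + 6 + |cross classes| ≤ N + 1` and the
determinant is not identically zero, it has at most `N` real zeros counted with multiplicity. [folklore] -/
theorem doublyConfluentDet_zerosWithMultiplicity_le (N : ℕ) (E : Fin 4 → ℝ) (τ T τ' T' : Matrix (Fin 2) (Fin 2) ℝ)
    (S : Fin 2 → Matrix (Fin 2) (Fin 2) ℝ)
    (hN : ((univ : Finset (Fin 4 × Fin 4)).image (fun p => E p.1 + E p.2)).card + 6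
      + ((univ : Finset (Fin 2)).image (fun k => E 0 + E k.succ.succ) ∪ (univ : Finset (Fin 2)).image (fun k => E 1 + E k.succ.succ)).card
        ≤ N + 1)
    (hne : ∃ t : ℝ, ((Real.exp (E 0 * t)) • (τ + t • T) + (Real.exp (E 1 * t)) • (τ' + t • T')
        + ∑ k, (Real.exp (E k.succ.succ * t)) • S k).det ≠ 0) :
    ZerosWithMultiplicityLE (fun t : ℝ => ((Real.exp (E 0 * t)) • (τ + t • T) + (Real.exp (E 1 * t)) • (τ' + t • T')
        + ∑ k, (Real.exp (E k.succ.succ * t)) • S k).det) Set.univ N := by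
  classical
  obtain ⟨P, hrep, hdegP⟩ := doublyConfluentDet_extSum E τ T τ' T' S
  have hact : ∃ w ∈ (univ : Finset (Fin 4 × Fin 4)).image (fun p => E p.1 + E p.2), P w ≠ 0 := by
    by_contra h
    push Not at h
    obtain ⟨t, ht⟩ := hne
    exact ht (by rw [hrep t]; exact Finset.sum_eq_zero fun w hw => by rw [h w hw, eval_zero, zero_mul])
  have hslots := doublyConfluentDet_slots_le E P hdegP
  rw [show (fun t : ℝ => ((Real.exp (E 0 * t)) • (τ + t • T) + (Real.exp (E 1 * t)) • (τ' + t • T')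
        + ∑ k, (Real.exp (E k.succ.succ * t)) • S k).det) = _ from funext hrep]
  exact extSum_zerosWithMultiplicity_le N _ P hact (by omega)

/-- **THE DOUBLY-CONFLUENT `(2,6)` DETERMINANT HAS AT MOST `19` REAL ZEROS WITH MULTIPLICITY — UNCONDITIONALLY.**  For EVERY `E : Fin 4 → ℝ`
(no injectivity, no door) and all `τ, T, τ′, T′, S₀, S₁`, if `F(t) = det(e^{e₀t}(τ + tT) + e^{e₁t}(τ′ + tT′) + e^{e₂t}S₀ + e^{e₃t}S₁)` is not
identically zero then its real zeros counted with multiplicity number `≤ 19` (slots `≤ 10 + 6 + 4 = 20`).  At one Weyl pair the corresponding number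
is the generic `20` and `≤ 19` is the OPEN door `ConfluentDoor26`; at two Weyl pairs `≤ 19` is automatic. [this work] -/
theorem doublyConfluentDet_zerosWithMultiplicity_le_nineteen (E : Fin 4 → ℝ) (τ T τ' T' : Matrix (Fin 2) (Fin 2) ℝ)
    (S : Fin 2 → Matrix (Fin 2) (Fin 2) ℝ)
    (hne : ∃ t : ℝ, ((Real.exp (E 0 * t)) • (τ + t • T) + (Real.exp (E 1 * t)) • (τ' + t • T')
        + ∑ k, (Real.exp (E k.succ.succ * t)) • S k).det ≠ 0) :
    ZerosWithMultiplicityLE (fun t : ℝ => ((Real.exp (E 0 * t)) • (τ + t • T) + (Real.exp (E 1 * t)) • (τ' + t • T')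
        + ∑ k, (Real.exp (E k.succ.succ * t)) • S k).det) Set.univ 19 :=
  doublyConfluentDet_zerosWithMultiplicity_le 19 E τ T τ' T' S
    (by have h1 := (card_pairSums_four E).1; have h2 := card_crossSums_le_four E; omega) hne

/-- **`≤ 18` under a value coincidence.**  If two distinct canonical pair sums of `E` coincide (in particular on the two-Weyl-pair WALL strata
(c1) `e₀ + e₁ = e₂ + e₃`, (c2) `e₀ + e₂ = e₁ + e₃`, (c3) `e₀ + e₃ = e₁ + e₂` of `Stmt.weylFaces_wall`), a non-identically-zero doubly-confluent
determinant has at most `18` real zeros with multiplicity. [this work] -/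
theorem doublyConfluentDet_zerosWithMultiplicity_le_eighteen_of_coincidence (E : Fin 4 → ℝ) (τ T τ' T' : Matrix (Fin 2) (Fin 2) ℝ)
    (S : Fin 2 → Matrix (Fin 2) (Fin 2) ℝ)
    (hcoin : ∃ a b c d : Fin 4, a ≤ b ∧ c ≤ d ∧ (a, b) ≠ (c, d) ∧ E a + E b = E c + E d)
    (hne : ∃ t : ℝ, ((Real.exp (E 0 * t)) • (τ + t • T) + (Real.exp (E 1 * t)) • (τ' + t • T')
        + ∑ k, (Real.exp (E k.succ.succ * t)) • S k).det ≠ 0) :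
    ZerosWithMultiplicityLE (fun t : ℝ => ((Real.exp (E 0 * t)) • (τ + t • T) + (Real.exp (E 1 * t)) • (τ' + t • T')
        + ∑ k, (Real.exp (E k.succ.succ * t)) • S k).det) Set.univ 18 :=
  doublyConfluentDet_zerosWithMultiplicity_le 18 E τ T τ' T' S
    (by have h1 := (card_pairSums_four E).2 hcoin; have h2 := card_crossSums_le_four E; omega) hne

/-- **`≤ 17` under a cross relation** (the wall cases (c2) `e₀ + e₂ = e₁ + e₃` / (c3) `e₀ + e₃ = e₁ + e₂`): a cross class of the
determinant merges as well, slots `≤ 9 + 6 + 3 = 18`. [this work] -/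
theorem doublyConfluentDet_zerosWithMultiplicity_le_seventeen_of_crossRel (E : Fin 4 → ℝ) (τ T τ' T' : Matrix (Fin 2) (Fin 2) ℝ)
    (S : Fin 2 → Matrix (Fin 2) (Fin 2) ℝ)
    (hrel : ∃ k l : Fin 2, E 0 + E k.succ.succ = E 1 + E l.succ.succ)
    (hne : ∃ t : ℝ, ((Real.exp (E 0 * t)) • (τ + t • T) + (Real.exp (E 1 * t)) • (τ' + t • T')
        + ∑ k, (Real.exp (E k.succ.succ * t)) • S k).det ≠ 0) :
    ZerosWithMultiplicityLE (fun t : ℝ => ((Real.exp (E 0 * t)) • (τ + t • T) + (Real.exp (E 1 * t)) • (τ' + t • T')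
        + ∑ k, (Real.exp (E k.succ.succ * t)) • S k).det) Set.univ 17 := by
  have hcoin : ∃ a b c d : Fin 4, a ≤ b ∧ c ≤ d ∧ (a, b) ≠ (c, d) ∧ E a + E b = E c + E d := by
    obtain ⟨k, l, hkl⟩ := hrel
    refine ⟨0, k.succ.succ, 1, l.succ.succ, Fin.zero_le _, ?_, ?_, hkl⟩
    · exact Fin.le_def.mpr (by simp only [Fin.val_one, Fin.val_succ]; omega)
    · intro h
      exact Fin.zero_ne_one (Prod.mk.inj h).1
  exact doublyConfluentDet_zerosWithMultiplicity_le 17 E τ T τ' T' S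
    (by have h1 := (card_pairSums_four E).2 hcoin; have h2 := card_crossSums_le_three_of_rel E hrel; omega) hne

/-- **The count in the shape W2's door step consumes** (`…ConfluentTower.no_twenty_window_of_confluentDoor`, with `19` in place of the door):
`∀ Z m, (∀ z ∈ Z, ∀ j < m z, iteratedDeriv j F z = 0) → Σ_{z∈Z} m z ≤ 19`, for every `E` and every non-identically-zero doubly-confluent
determinant. [this work] -/
theorem doublyConfluent_count_conclusion (E : Fin 4 → ℝ) (τ T τ' T' : Matrix (Fin 2) (Fin 2) ℝ) (S : Fin 2 → Matrix (Fin 2) (Fin 2) ℝ)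
    (hne : ∃ t : ℝ, ((Real.exp (E 0 * t)) • (τ + t • T) + (Real.exp (E 1 * t)) • (τ' + t • T')
        + ∑ k, (Real.exp (E k.succ.succ * t)) • S k).det ≠ 0)
    (Z : Finset ℝ) (m : ℝ → ℕ)
    (hZ : ∀ z ∈ Z, ∀ j < m z, iteratedDeriv j (fun t : ℝ => ((Real.exp (E 0 * t)) • (τ + t • T) + (Real.exp (E 1 * t)) • (τ' + t • T')
        + ∑ k, (Real.exp (E k.succ.succ * t)) • S k).det) z = 0) :
    ∑ z ∈ Z, m z ≤ 19 :=
  doublyConfluentDet_zerosWithMultiplicity_le_nineteen E τ T τ' T' S hne Z m (fun z hz => ⟨Set.mem_univ _, hZ z hz⟩)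

end Summit.ValiantsHypothesis.ValiantsHypothesis.Theorems.LacunarySymmetroidMatrixDescartes.WallBubbling.Bubbling
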